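import Summits.RiemannHypothesis.RiemannHypothesis.Theorems.Splittings.LiIndexSetsPrelims
import HarnessLib

/-!
# Splittings — Li index sets, part 2/3: RECURRENT index sets, thick sets, partition regularity, and the
# non-recurrent side (divisibility obstructions, the `q`-Beurling family)

Cell rh-split, seat rh-split-li-neg g2 (brief sha16 f79c5f09d8bcb036), card `run/shared/lean/pub/rh-split/cards/SPLIT-li-neg.md`
gen-2 addendum.  The g0 card closed every TAIL / HEIGHT / GROWTH / ARITHMETIC splitting of
`E_Li : RH ↔ ∀ n ≥ 1, λ_n ≥ 0` (`li_criterion_holds`) as «no slack», and BP-1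
(`Theorems/Splittings/LiCriterionProgressions.lean`) added the progressions `qℕ`.  The one axis left open in the
g0 census (V10/V12: «sparse / lacunary / syndetic index sets») is settled STRUCTURALLY by the notions of this file
(definitions, reviewed lane) and the theorems of part 3/3 (`LiIndexSets.lean`):

* `IsLiRecurrent S` — the index set `S` is RECURRENT for finite families of unit complex numbers (for every
  `z₁, …, z_k` on the unit circle and every `N` some `n ∈ S`, `n ≥ N`, has `Re z_iⁿ ≥ ½` for all `i`; equivalently
  `0` is a Bohr-recurrence point of `S`); `LiPosOn S` — `λ_n ≥ 0` for every `n ∈ S`, `n ≥ 1`;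
* closure properties: supersets (`IsLiRecurrent.mono`), finite changes (`IsLiRecurrent.of_eventually_subset`),
  **partition regularity** (`IsLiRecurrent.union`, `isLiRecurrent_or_compl`, `IsLiRecurrent.exists_of_biUnion`: of
  any finite colouring of a recurrent set one colour class is recurrent); examples: `ℕ`, co-finite sets, tails of
  progressions `qℕ` (`isLiRecurrent_mul_tail`), block-sum (IP-type) sets (`isLiRecurrent_of_blockSums_mem`, from
  part 1/3), and THICK sets `IsThick S` (arbitrarily long runs of consecutive integers; `IsThick.isLiRecurrent` —
  new on the index axis: neither a tail nor a progression);
* the NON-recurrent side: a set avoiding all multiples of some `q` is not recurrent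
  (`not_isLiRecurrent_of_forall_not_dvd`: odd numbers, primes, squarefree numbers, powers of two, a residue class
  `a mod q` with `q ∤ a`), and at the MULTISET level the index-set Li criterion `MultisetLiCriterionOn S` (for every
  Bombieri–Lagarias family, positivity of the Li sums on `S` forces `Re ρ_i ≥ ½`) FAILS on every such set,
  witnessed by the explicit **`q`-Beurling family** `beurlingFamily q r j = (1 − r ζ_q^j)⁻¹` (`j < q`, `r > 1`; every
  `Re ρ_j < ½`, Li sums `= q > 0` off the multiples of `q`): `not_multisetLiCriterionOn_of_forall_not_dvd`,
  `frequently_dvd_of_multisetLiCriterionOn`.  So any proof of «λ_p ≥ 0 ∀ primes p ⟹ RH» must use information about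
  the low zeros of ζ (none is claimed here).

References: E. Bombieri, J. C. Lagarias, J. Number Theory 77 (1999) 274–287, Thm. 1 [BombieriLagarias1999];
X.-J. Li, J. Number Theory 65 (1997) 325–333 [Li1997].

Provenance: cell rh-split, seat rh-split-li-neg g2, scratch `HOME/rh-split-li-neg/LiIndexSets.lean` (sha16
a6d03a2d9de497a7, 964 lines, namespace `…Scratch.LiIndexSets`; proofs verbatim), re-homed under
`Theorems/Splittings/` in three files (`LiIndexSetsPrelims` — definition-free estimates; `LiIndexSetsRecurrence` —
the notions `IsLiRecurrent` / `LiPosOn` / `IsThick` / `beurlingFamily` / `MultisetLiCriterionOn` and their API;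
`LiIndexSets` — Bombieri–Lagarias along a recurrent index set and the zeta-level dichotomy) by rh-split-typer-1 g2
on the lead's ruling 2026-08-26T20:32Z (BY-PRODUCT BP-6; optional filing after referee replay + label).  Referee
(rh-split-ref g0) addendum 20:37Z on cards/SPLIT-li-neg.md: replay rc 0, std on `riemannHypothesis_iff_liPosOn`;
«dichotomy (RH ↔ LiPosOn S) ∨ (RH ↔ LiPosOn Sᶜ) for EVERY S — partition-regularity step and q-Beurling
non-recurrent witness re-checked by hand; LABEL: Li index axis = NO SLACK BY THEOREM (recurrent parts RH-equivalent
alone, F1-free; non-recurrent parts RH-implied, ζ-level converse undecided, multiset-level refuted in kernel)».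
Typer-1 g2 replay of the 964-line scratch: farm rc 0, 0 warnings, 0 sorry, `#print axioms li_index_dichotomy_raw` =
[propext, Classical.choice, Quot.sound].

HONEST LABEL: «SPLITTING SEARCH over kernel-typed RH-EQUIVALENCES; a splitting A ∧ B ⟹ RH is CONDITIONAL
bookkeeping unless A and B are both proved; nothing here bears on the truth of RH.»
-/

set_option linter.dupNamespace false

noncomputable section

open Complex Filter Topology Set
open scoped ComplexConjugate Real

namespace Summit.RiemannHypothesis.RiemannHypothesis.Theorems.Splittings.LiIndexSets

open Literature.NumberTheory.LFunctions
open Literature.NumberTheory.LFunctions.BombieriLagarias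
open Summit.RiemannHypothesis.RiemannHypothesis.Theorems.Splittings

/-! ## §1 Recurrent index sets -/

/-- `S ⊆ ℕ` is **Li-recurrent**: for every finite family of unit complex numbers and every `N`, some
`n ∈ S` with `n ≥ N` has `Re (z_iⁿ) ≥ 1/2` simultaneously for all `i` (⟺ `0` is a Bohr-recurrence
point of `S`). -/
@[folklore] def IsLiRecurrent (S : Set ℕ) : Prop :=
  ∀ (k : ℕ) (z : Fin k → ℂ), (∀ i, ‖z i‖ = 1) → ∀ N : ℕ, ∃ n ∈ S, N ≤ n ∧ ∀ i, (1 : ℝ) / 2 ≤ (z i ^ n).re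

/-- **Li positivity on an index set**: `λ_n ≥ 0` for every `n ∈ S`, `n ≥ 1`. -/
@[folklore] def LiPosOn (S : Set ℕ) : Prop := ∀ n ∈ S, 1 ≤ n → 0 ≤ keiperLiCoeff n

/-- Recurrence passes to supersets. -/
theorem IsLiRecurrent.mono {S T : Set ℕ} (hS : IsLiRecurrent S) (hST : S ⊆ T) : IsLiRecurrent T := by
  intro k z hz N
  obtain ⟨n, hnS, hNn, hn⟩ := hS k z hz N
  exact ⟨n, hST hnS, hNn, hn⟩

/-- Finset-indexed form of recurrence. -/
theorem IsLiRecurrent.finset {S : Set ℕ} (hS : IsLiRecurrent S) {ι : Type*} (B : Finset ι)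
    (z : ι → ℂ) (hz : ∀ i ∈ B, ‖z i‖ = 1) (N : ℕ) :
    ∃ n ∈ S, N ≤ n ∧ ∀ i ∈ B, 1 / 2 ≤ (z i ^ n).re := by
  classical
  obtain ⟨n, hnS, hNn, hn⟩ := hS B.card (fun j ↦ z (B.equivFin.symm j))
    (fun j ↦ hz _ (B.equivFin.symm j).2) N
  refine ⟨n, hnS, hNn, fun i hi ↦ ?_⟩
  have := hn (B.equivFin ⟨i, hi⟩)
  simpa using this

/-- The empty set is not recurrent. -/
theorem not_isLiRecurrent_empty : ¬ IsLiRecurrent (∅ : Set ℕ) := by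
  intro h
  obtain ⟨n, hn, -⟩ := h 0 (fun i ↦ i.elim0) (fun i ↦ i.elim0) 0
  exact hn

/-- **Partition regularity.** If `S ∪ T` is recurrent then `S` or `T` is (join the two witness
families into one). -/
theorem IsLiRecurrent.union {S T : Set ℕ} (h : IsLiRecurrent (S ∪ T)) :
    IsLiRecurrent S ∨ IsLiRecurrent T := by
  by_contra hc
  push Not at hc
  obtain ⟨hS, hT⟩ := hc
  unfold IsLiRecurrent at hS hT
  push Not at hS hT
  obtain ⟨k₁, z₁, hz₁, N₁, h₁⟩ := hS
  obtain ⟨k₂, z₂, hz₂, N₂, h₂⟩ := hT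
  have hz : ∀ i, ‖Fin.append z₁ z₂ i‖ = 1 := by
    intro i
    refine Fin.addCases (fun i ↦ ?_) (fun i ↦ ?_) i
    · rw [Fin.append_left]; exact hz₁ i
    · rw [Fin.append_right]; exact hz₂ i
  obtain ⟨n, hn, hNn, hre⟩ := h (k₁ + k₂) (Fin.append z₁ z₂) hz (max N₁ N₂)
  rcases hn with hn | hn
  · obtain ⟨i, hi⟩ := h₁ n hn ((le_max_left _ _).trans hNn)
    have := hre (Fin.castAdd k₂ i)
    rw [Fin.append_left] at this
    linarith
  · obtain ⟨i, hi⟩ := h₂ n hn ((le_max_right _ _).trans hNn)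
    have := hre (Fin.natAdd k₁ i)
    rw [Fin.append_right] at this
    linarith

/-- Of finitely many sets with recurrent union, one is recurrent. -/
theorem IsLiRecurrent.exists_of_biUnion {α : Type*} (F : Finset α) (S : α → Set ℕ)
    (h : IsLiRecurrent (⋃ a ∈ F, S a)) : ∃ a ∈ F, IsLiRecurrent (S a) := by
  classical
  induction F using Finset.induction_on with
  | empty =>
    have he : (⋃ a ∈ (∅ : Finset α), S a) = (∅ : Set ℕ) := by simp
    rw [he] at h
    exact absurd h not_isLiRecurrent_empty
  | insert a F ha ih =>
    rw [Finset.set_biUnion_insert] at h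
    rcases h.union with h | h
    · exact ⟨a, Finset.mem_insert_self _ _, h⟩
    · obtain ⟨b, hb, hb'⟩ := ih h
      exact ⟨b, Finset.mem_insert_of_mem hb, hb'⟩

/-! ## §2 Examples of recurrent sets: ℕ, co-finite sets, progression tails, block sums, thick sets -/



/-- A set containing every block sum `x_m + … + x_{m'−1}` (`m < m'`) of a sequence of positive
integers is recurrent. -/
theorem isLiRecurrent_of_blockSums_mem {S : Set ℕ} (x : ℕ → ℕ) (hx : ∀ j, 1 ≤ x j)
    (h : ∀ m m', m < m' → ∑ j ∈ Finset.Ico m m', x j ∈ S) : IsLiRecurrent S := by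
  intro k z hz N
  obtain ⟨m, m', hmm', hN, hre⟩ :=
    exists_blockSum_forall_half_le_re_pow (Finset.univ : Finset (Fin k)) z (fun i _ ↦ hz i) x hx N
  exact ⟨_, h m m' hmm', hN, fun i ↦ hre i (Finset.mem_univ i)⟩

/-- `ℕ` is recurrent (Dirichlet / Bolzano–Weierstrass). -/
theorem isLiRecurrent_univ : IsLiRecurrent (Set.univ : Set ℕ) :=
  isLiRecurrent_of_blockSums_mem (fun _ ↦ 1) (fun _ ↦ le_rfl) (fun _ _ _ ↦ Set.mem_univ _)

/-- Co-finite sets are recurrent (recurrence only sees `S` up to finite sets). -/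
theorem isLiRecurrent_of_forall_lt_mem {S : Set ℕ} {K : ℕ} (h : ∀ n, K < n → n ∈ S) :
    IsLiRecurrent S := by
  refine isLiRecurrent_of_blockSums_mem (fun _ ↦ K + 1) (fun _ ↦ by omega) fun m m' hmm' ↦ h _ ?_
  have : ∑ j ∈ Finset.Ico m m', (K + 1) = (m' - m) * (K + 1) := by simp
  rw [this]
  calc K < K + 1 := Nat.lt_succ_self K
    _ = 1 * (K + 1) := (one_mul _).symm
    _ ≤ (m' - m) * (K + 1) := Nat.mul_le_mul_right _ (by omega)

/-- The tail `{qk : k > K}` of the progression `qℕ` (`q ≥ 1`) is recurrent. -/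
theorem isLiRecurrent_mul_tail {q : ℕ} (hq : 1 ≤ q) (K : ℕ) :
    IsLiRecurrent {n | ∃ k, K < k ∧ n = q * k} := by
  refine isLiRecurrent_of_blockSums_mem (fun _ ↦ q * (K + 1))
    (fun _ ↦ Nat.one_le_iff_ne_zero.2 (Nat.mul_ne_zero (by omega) (by omega))) fun m m' hmm' ↦ ?_
  refine ⟨(K + 1) * (m' - m), ?_, ?_⟩
  · calc K < K + 1 := Nat.lt_succ_self K
      _ = (K + 1) * 1 := (mul_one _).symm
      _ ≤ (K + 1) * (m' - m) := Nat.mul_le_mul_left _ (by omega)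
  · have : ∑ j ∈ Finset.Ico m m', q * (K + 1) = (m' - m) * (q * (K + 1)) := by simp
    rw [this]; ring

/-- Recurrence ignores finite pieces: a set that eventually contains a recurrent set is recurrent. -/
theorem IsLiRecurrent.of_eventually_subset {S T : Set ℕ} (hS : IsLiRecurrent S) {K : ℕ}
    (h : ∀ n, K < n → n ∈ S → n ∈ T) : IsLiRecurrent T := by
  intro k z hz N
  obtain ⟨n, hnS, hNn, hn⟩ := hS k z hz (max N (K + 1))
  exact ⟨n, h n (by omega) hnS, (le_max_left _ _).trans hNn, hn⟩

/-- `S` is **thick**: it contains arbitrarily long runs of consecutive integers. -/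
@[folklore] def IsThick (S : Set ℕ) : Prop := ∀ L : ℕ, ∃ a : ℕ, ∀ t, t ≤ L → a + t ∈ S

/-- A thick set has runs `[a, a+L] ⊆ S` with `a ≥ 1`. -/
private theorem IsThick.pos {S : Set ℕ} (hS : IsThick S) (L : ℕ) :
    ∃ a, 1 ≤ a ∧ ∀ t, t ≤ L → a + t ∈ S := by
  obtain ⟨a, ha⟩ := hS (L + 1)
  refine ⟨a + 1, by omega, fun t ht ↦ ?_⟩
  have := ha (t + 1) (by omega)
  rwa [show a + (t + 1) = a + 1 + t by ring] at this

/-- Greedy run starts: `P_{k+1} = P_k + a(P_k)`, where `[a(T), a(T) + T] ⊆ S`. [folklore] -/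
private def thickP (a : ℕ → ℕ) : ℕ → ℕ
  | 0 => 0
  | k + 1 => thickP a k + a (thickP a k)

/-- Unfolding of the greedy run starts. -/
private theorem thickP_succ (a : ℕ → ℕ) (k : ℕ) : thickP a (k + 1) = thickP a k + a (thickP a k) := rfl

/-- The greedy run starts are monotone. -/
private theorem thickP_mono (a : ℕ → ℕ) : Monotone (thickP a) :=
  monotone_nat_of_le_succ fun k ↦ by rw [thickP_succ]; omega

/-- Telescoping: `Σ_{k ∈ [m,m')} a(P_k) = P_{m'} - P_m`. -/
private theorem sum_Ico_thickP (a : ℕ → ℕ) {m m' : ℕ} (h : m ≤ m') :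
    ∑ j ∈ Finset.Ico m m', a (thickP a j) = thickP a m' - thickP a m := by
  induction m', h using Nat.le_induction with
  | base => simp
  | succ m' hmm' ih =>
    rw [Finset.sum_Ico_succ_top hmm', ih, thickP_succ]
    have := thickP_mono a hmm'
    omega

/-- **Thick sets are recurrent**: a thick set contains the block-sum system of the greedy sequence
`x_k = a(P_k)` (every block sum `x_m + … + x_{m'-1} = a(P_{m'-1}) + (P_{m'-1} − P_m)` lies in the run
`[a(P_{m'-1}), a(P_{m'-1}) + P_{m'-1}] ⊆ S`). -/
theorem IsThick.isLiRecurrent {S : Set ℕ} (hS : IsThick S) : IsLiRecurrent S := by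
  choose a ha1 ha using hS.pos
  refine isLiRecurrent_of_blockSums_mem (fun j ↦ a (thickP a j)) (fun j ↦ ha1 _) fun m m' hmm' ↦ ?_
  rw [sum_Ico_thickP a hmm'.le]
  obtain ⟨d, rfl⟩ := Nat.exists_eq_add_of_lt hmm'
  rw [thickP_succ]
  have hle : thickP a m ≤ thickP a (m + d) := thickP_mono a (by omega)
  have hmem := ha (thickP a (m + d)) (thickP a (m + d) - thickP a m) (by omega)
  have e : thickP a (m + d) + a (thickP a (m + d)) - thickP a m
      = a (thickP a (m + d)) + (thickP a (m + d) - thickP a m) := by omega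
  rw [e]; exact hmem

/-- Any set is recurrent or has recurrent complement. -/
theorem isLiRecurrent_or_compl (S : Set ℕ) : IsLiRecurrent S ∨ IsLiRecurrent Sᶜ := by
  have h : IsLiRecurrent (S ∪ Sᶜ) := by rw [Set.union_compl_self]; exact isLiRecurrent_univ
  exact h.union

/-! ## §3 The non-recurrent side: divisibility obstructions and the `q`-Beurling family -/

/-- A set avoiding every multiple of some `q ≥ 1` is NOT recurrent (family `ζ_q^j`, `j < q`: the
root-of-unity filter `Σ_j ζ_q^{jn} = 0` for `q ∤ n` is incompatible with `Re ζ_q^{jn} ≥ 1/2 ∀ j`). -/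
theorem not_isLiRecurrent_of_forall_not_dvd {S : Set ℕ} {q : ℕ} (hq : 1 ≤ q)
    (hS : ∀ n ∈ S, ¬ q ∣ n) : ¬ IsLiRecurrent S := by
  intro h
  obtain ⟨n, hnS, -, hre⟩ := h q (fun j ↦ exp (2 * π * I / q) ^ (j : ℕ))
    (fun j ↦ LiProgression.norm_rootOfUnity_pow (by omega) _) 0
  have hsum := LiProgression.sum_rootOfUnity_pow_mul (q := q) (by omega) n
  rw [if_neg (hS n hnS)] at hsum
  have hre0 : ∑ j ∈ Finset.range q, ((exp (2 * π * I / q) ^ j) ^ n).re = 0 := by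
    rw [← Complex.re_sum, hsum, Complex.zero_re]
  have hpos : (q : ℝ) * (1 / 2) ≤ ∑ j ∈ Finset.range q, ((exp (2 * π * I / q) ^ j) ^ n).re := by
    calc (q : ℝ) * (1 / 2) = ∑ j ∈ Finset.range q, (1 / 2 : ℝ) := by simp
      _ ≤ _ := Finset.sum_le_sum fun j hj ↦ hre ⟨j, Finset.mem_range.1 hj⟩
  have hq1 : (1 : ℝ) ≤ q := by exact_mod_cast hq
  linarith

/-- A recurrent set meets every progression `qℕ` (`q ≥ 1`) infinitely often. -/
theorem IsLiRecurrent.exists_dvd {S : Set ℕ} (hS : IsLiRecurrent S) {q : ℕ} (hq : 1 ≤ q) (K : ℕ) :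
    ∃ n ∈ S, K < n ∧ q ∣ n := by
  by_contra hc
  push Not at hc
  have hT : IsLiRecurrent {n | n ∈ S ∧ K < n} := hS.of_eventually_subset (K := K) fun n hK hn ↦ ⟨hn, hK⟩
  exact not_isLiRecurrent_of_forall_not_dvd hq (fun n hn ↦ hc n hn.1 hn.2) hT

/-- The odd numbers are not recurrent. -/
theorem not_isLiRecurrent_odd : ¬ IsLiRecurrent {n | Odd n} :=
  not_isLiRecurrent_of_forall_not_dvd (q := 2) (by norm_num) fun n hn h2 ↦ by
    rcases hn with ⟨k, hk⟩; omega

/-- A residue class `a mod q` with `q ∤ a` is not recurrent. -/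
theorem not_isLiRecurrent_residueClass {q a : ℕ} (hq : 1 ≤ q) (ha : ¬ q ∣ a) :
    ¬ IsLiRecurrent {n | n % q = a % q} :=
  not_isLiRecurrent_of_forall_not_dvd hq fun n (hn : n % q = a % q) h ↦ ha (by
    rw [Nat.dvd_iff_mod_eq_zero] at h ⊢; omega)

/-- The primes are not recurrent (`4 ∤ p`). -/
theorem not_isLiRecurrent_primes : ¬ IsLiRecurrent {p | p.Prime} :=
  not_isLiRecurrent_of_forall_not_dvd (q := 4) (by norm_num) fun p (hp : p.Prime) h4 ↦ by
    rcases hp.eq_one_or_self_of_dvd 4 h4 with h | h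
    · omega
    · subst h; exact absurd hp (by norm_num)

/-- The squarefree numbers are not recurrent (`4 ∤ n`). -/
theorem not_isLiRecurrent_squarefree : ¬ IsLiRecurrent {n | Squarefree n} :=
  not_isLiRecurrent_of_forall_not_dvd (q := 4) (by norm_num) fun n (hn : Squarefree n) h4 ↦ by
    have h22 : (2 : ℕ) * 2 ∣ n := by simpa using h4
    have := Nat.isUnit_iff.1 (hn 2 h22)
    omega

/-- The powers of two are not recurrent (`3 ∤ 2^k`). -/
theorem not_isLiRecurrent_powTwo : ¬ IsLiRecurrent {n | ∃ k, n = 2 ^ k} :=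
  not_isLiRecurrent_of_forall_not_dvd (q := 3) (by norm_num) fun n hn h3 ↦ by
    obtain ⟨k, rfl⟩ := hn
    have := Nat.Prime.dvd_of_dvd_pow Nat.prime_three h3
    omega

/-- The **`q`-Beurling family**: `ρ_j = (1 − r ζ_q^j)⁻¹`, `j < q` (so `1 − 1/ρ_j = r ζ_q^j`). -/
@[folklore] def beurlingFamily (q : ℕ) (r : ℝ) (j : Fin q) : ℂ := (1 - (r : ℂ) * exp (2 * π * I / q) ^ (j : ℕ))⁻¹




/-- Every member of the `q`-Beurling family (`r > 1`) is `≠ 0`, `≠ 1` and strictly LEFT of the critical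
line. -/
theorem beurlingFamily_re_lt_half {q : ℕ} (hq : 1 ≤ q) {r : ℝ} (hr : 1 < r) (j : Fin q) :
    beurlingFamily q r j ≠ 0 ∧ beurlingFamily q r j ≠ 1 ∧ (beurlingFamily q r j).re < 1 / 2 := by
  have hw : 1 < ‖(r : ℂ) * exp (2 * π * I / q) ^ (j : ℕ)‖ := by
    rw [norm_beurling_w (by omega) (by linarith) j]; exact hr
  refine ⟨inv_ne_zero (one_sub_ne_zero_of_one_lt_norm hw), fun h ↦ ?_, re_inv_one_sub_lt_half hw⟩
  have h' := congrArg (·⁻¹) h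
  simp only [beurlingFamily, inv_inv, inv_one] at h'
  have hw0 : (r : ℂ) * exp (2 * π * I / q) ^ (j : ℕ) = 0 := by linear_combination -h'
  rw [hw0, norm_zero] at hw
  linarith

/-- `1 − 1/ρ_j = r ζ_q^j` for the `q`-Beurling family. -/
theorem one_sub_one_div_beurlingFamily {q : ℕ} (r : ℝ) (j : Fin q) :
    1 - 1 / beurlingFamily q r j = (r : ℂ) * exp (2 * π * I / q) ^ (j : ℕ) := by
  simp only [beurlingFamily, one_div, inv_inv, sub_sub_cancel]


/-- **Li sums of the `q`-Beurling family off the multiples of `q` are `= q > 0`.** -/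
theorem beurlingFamily_sum_of_not_dvd {q : ℕ} (hq : 1 ≤ q) (r : ℝ) {n : ℕ} (hn : ¬ q ∣ n) :
    ∑ j : Fin q, (1 - (1 - 1 / beurlingFamily q r j) ^ n).re = q := by
  simp only [one_sub_one_div_beurlingFamily]
  rw [Fin.sum_univ_eq_sum_range (fun j ↦ (1 - ((r : ℂ) * exp (2 * π * I / q) ^ j) ^ n).re) q,
    beurling_sum_eq (by omega), if_neg hn]

/-- **… and at the multiples `n ≥ 1` of `q` they are `q(1 − rⁿ) < 0`.** -/
theorem beurlingFamily_sum_of_dvd {q : ℕ} (hq : 1 ≤ q) {r : ℝ} (hr : 1 < r) {n : ℕ} (hn1 : 1 ≤ n)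
    (hn : q ∣ n) : ∑ j : Fin q, (1 - (1 - 1 / beurlingFamily q r j) ^ n).re < 0 := by
  simp only [one_sub_one_div_beurlingFamily]
  rw [Fin.sum_univ_eq_sum_range (fun j ↦ (1 - ((r : ℂ) * exp (2 * π * I / q) ^ j) ^ n).re) q,
    beurling_sum_eq (by omega), if_pos hn]
  have hq0 : (0 : ℝ) < q := by exact_mod_cast hq
  have hrn : 1 < r ^ n := one_lt_pow₀ hr (by omega)
  nlinarith

/-- The **index-set Li criterion at the multiset level** for `S`: for EVERY Bombieri–Lagarias family
(`ρ_i ≠ 0, 1`, multiplicities `m_i ≥ 1`, summable reflected weight — the hypotheses of the tree's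
`bombieriLagarias1999_theorem1_pos`), positivity of the Li sums at the indices `n ∈ S` forces
`Re ρ_i ≥ 1/2` for all `i`. -/
@[folklore] def MultisetLiCriterionOn (S : Set ℕ) : Prop :=
  ∀ (ι : Type) (ρ : ι → ℂ) (m : ι → ℕ), (∀ i, 0 < m i) → (∀ i, ρ i ≠ 0) → (∀ i, ρ i ≠ 1) →
    Summable (weight (fun i ↦ 1 - conj (ρ i)) m) →
    (∀ n ∈ S, 1 ≤ n → 0 ≤ ∑' i, (m i : ℝ) * (1 - (1 - 1 / ρ i) ^ n).re) → ∀ i, 1 / 2 ≤ (ρ i).re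

/-- **The multiset-level criterion FAILS on every set avoiding the multiples of some `q`** (odd
numbers, primes, squarefree numbers, powers of two, classes `a mod q` with `q ∤ a`, …): witnessed by
the `q`-Beurling family. -/
theorem not_multisetLiCriterionOn_of_forall_not_dvd {S : Set ℕ} {q : ℕ} (hq : 1 ≤ q)
    (hS : ∀ n ∈ S, 1 ≤ n → ¬ q ∣ n) : ¬ MultisetLiCriterionOn S := by
  intro h
  have hmem := fun j ↦ beurlingFamily_re_lt_half hq (one_lt_two : (1 : ℝ) < 2) j
  have hsum : Summable (weight (fun j ↦ 1 - conj (beurlingFamily q 2 j)) (fun _ ↦ 1)) :=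
    (hasSum_fintype _).summable
  have hq0 : 0 < q := hq
  have hcrit := h (Fin q) (beurlingFamily q 2) (fun _ ↦ 1) (fun _ ↦ Nat.one_pos)
    (fun j ↦ (hmem j).1) (fun j ↦ (hmem j).2.1) hsum ?_ ⟨0, hq0⟩
  · exact absurd hcrit (not_le.2 (hmem ⟨0, hq0⟩).2.2)
  · intro n hnS hn1
    rw [tsum_fintype]
    simp only [Nat.cast_one, one_mul]
    rw [beurlingFamily_sum_of_not_dvd hq 2 (hS n hnS hn1)]
    exact Nat.cast_nonneg _

/-- A necessary condition for the multiset-level criterion: `S` meets every progression `qℕ`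
infinitely often (take the `q(K+1)`-Beurling family). -/
theorem frequently_dvd_of_multisetLiCriterionOn {S : Set ℕ} (h : MultisetLiCriterionOn S) {q : ℕ}
    (hq : 1 ≤ q) (K : ℕ) : ∃ n ∈ S, K < n ∧ q ∣ n := by
  by_contra hc
  push Not at hc
  refine not_multisetLiCriterionOn_of_forall_not_dvd (q := q * (K + 1))
    (Nat.one_le_iff_ne_zero.2 (Nat.mul_ne_zero (by omega) (by omega))) (fun n hnS hn1 hdvd ↦ ?_) h
  have hqn : q ∣ n := dvd_trans (Dvd.intro _ rfl) hdvd
  have hle : q * (K + 1) ≤ n := Nat.le_of_dvd (by omega) hdvd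
  have hKn : K < n := by nlinarith
  exact hc n hnS hKn hqn

end Summit.RiemannHypothesis.RiemannHypothesis.Theorems.Splittings.LiIndexSets

end
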